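import Literature.Probability.LatticeModels.SiteBurtonKeane
import Literature.Probability.LatticeModels.IsingFiniteEnergy
import Literature.Probability.LatticeModels.TailTrivialMixing
import HarnessLib

/-!
# Uniqueness of the infinite `±` cluster for `2ℤ^d`-periodic extremal Ising states

Topic `Probability/LatticeModels`; theorems only. The form in which Georgii–Higuchi 2000 invoke the
Burton–Keane theorem in Step 2 of the proof of the butterfly lemma (Lemma 3.1, p. 7): "for every
periodic `μ` with finite energy there exists at most one infinite `+` (resp. `-`) cluster … our `μ`
is extremal, and therefore `(ϑ_x)_{x∈2ℤ²}`-ergodic by Proposition (14.9) of [6]". Assembling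

* the finite energy property of Ising Gibbs measures (`IsingFiniteEnergy.lean`),
* ergodicity of a tail-trivial state under a non-zero shift preserving it
  (`TailTrivialMixing.lean`, Georgii 2011, Prop. 14.9), and
* the Burton–Keane argument for `2ℤ^d`-invariant, `2ℤ^d`-ergodic, finite-energy spin measures
  (`SiteBurtonKeane.lean`),

we obtain `IsGibbsMeasure.ae_siteCluster_unique_of_shift_invariant`: a tail-trivial
`μ ∈ 𝒢(β, h)` on `ℤ^d` which is invariant under the translations of `2ℤ^d` has, almost surely,
at most one infinite `s`-cluster for each sign `s`.

## References

* H.-O. Georgii, Y. Higuchi, J. Math. Phys. 41 (2000), proof of Lemma 3.1, Step 2, p. 7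
  [GeorgiiHiguchi2000].
* R. M. Burton, M. Keane, Comm. Math. Phys. 121 (1989) 501–505 [BurtonKeane1989].
* H.-O. Georgii, *Gibbs Measures and Phase Transitions*, 2nd ed. (2011), Prop. 14.9 [Georgii2011].
-/

noncomputable section

open MeasureTheory Filter
open Literature.Probability.Percolation (siteCluster siteOpenGraph numInfiniteClusters)

namespace Literature.Probability.LatticeModels

variable {d : ℕ} {β h : ℝ} {μ : Measure (SpinConfig (Site d))}

/-- `2 e₀ ≠ 0` in `ℤ^d`, `d ≥ 1`. [folklore] -/
theorem two_smul_single_ne_zero (hd : 1 ≤ d) :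
    (2 : ℤ) • (Pi.single (⟨0, hd⟩ : Fin d) 1 : Site d) ≠ 0 := by
  intro h0
  have := congrFun h0 ⟨0, hd⟩
  simp at this

/-- **Burton–Keane for periodic extremal Ising states** (Georgii–Higuchi 2000, proof of Lemma 3.1,
Step 2, p. 7): if `μ ∈ 𝒢(β, h)` on `ℤ^d` is tail trivial and invariant under the translations
`σ ↦ σ(· - 2v)`, `v ∈ ℤ^d`, then for each sign `s`, `μ`-almost surely the bond configuration of
the `s`-clusters has at most one infinite cluster. Finite energy: `IsingFiniteEnergy`; ergodicity
under `2ℤ^d`: Georgii 2011, Prop. 14.9 (`TailTrivialMixing`); the counting: `SiteBurtonKeane`. [cite: GeorgiiHiguchi2000, Lemma 3.1 (proof, Step 2, p. 7)] -/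
theorem IsGibbsMeasure.ae_numInfiniteClusters_spinBonds_le_one_of_shift_invariant
    (hμ : μ ∈ isingGibbsMeasures d β h) (hμt : IsTailTrivial μ)
    (hinv : ∀ v : Site d, μ.map (configRelabel (Site.shift ((2 : ℤ) • v))) = μ) (s : ℤˣ) :
    ∀ᵐ ω ∂μ, numInfiniteClusters (spinBonds (zdGraph d) s ω) ≤ 1 := by
  have hμG : IsGibbsMeasure (isingSpecification (zdGraph d) β h) μ := hμ
  haveI := hμG.isProbabilityMeasure
  rcases Nat.eq_zero_or_pos d with hd | hd
  · subst hd
    refine Eventually.of_forall fun ω => ?_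
    rw [Literature.Probability.Percolation.numInfiniteClusters_le_one_iff]
    intro x y hx
    exact absurd hx (Set.not_infinite.2 (Set.toFinite _))
  refine ae_numInfiniteClusters_spinBonds_le_one s hinv (fun A hA hAinv => ?_) fun N S hS hpos => ?_
  · exact IsTailTrivial.measure_eq_zero_or_one_of_shift_invariant hμt (two_smul_single_ne_zero hd)
      (hinv _) hA (hAinv _)
  · exact hμG.measure_ne_zero_of_glueWith (zdGraph d) (box d N) (fun _ => s) hS hpos

/-- **The same in the language of `s`-clusters**: under the hypotheses of the previous theorem,
`μ`-almost surely any two sites with infinite `s`-clusters are joined by a path of `s`-sites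
(Georgii–Higuchi 2000, p. 7: "there exist both a unique infinite `+`cluster `I⁺` and a unique
infinite `-`cluster `I⁻`"). [cite: GeorgiiHiguchi2000, Lemma 3.1 (proof, Step 2, p. 7)] -/
theorem IsGibbsMeasure.ae_siteCluster_unique_of_shift_invariant
    (hμ : μ ∈ isingGibbsMeasures d β h) (hμt : IsTailTrivial μ)
    (hinv : ∀ v : Site d, μ.map (configRelabel (Site.shift ((2 : ℤ) • v))) = μ) (s : ℤˣ) :
    ∀ᵐ ω ∂μ, ∀ x y, (siteCluster (zdGraph d) (spinSites s ω) x).Infinite →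
      (siteCluster (zdGraph d) (spinSites s ω) y).Infinite →
        (siteOpenGraph (zdGraph d) (spinSites s ω)).Reachable x y := by
  filter_upwards [IsGibbsMeasure.ae_numInfiniteClusters_spinBonds_le_one_of_shift_invariant
    hμ hμt hinv s] with ω hω
  exact numInfiniteClusters_spinBonds_le_one_iff.1 hω

end Literature.Probability.LatticeModels
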